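import Literature.Geometry.DiscreteGeometry.KissingFacets
import Literature.Geometry.DiscreteGeometry.SphericalPolygonFan
import HarnessLib

/-!
# The main estimate on the facets of the Delaunay polyhedron of a kissing configuration:
# the penalties of the fan triangles of all facets sum to at most `4π − 20 sol₀`
# (Hales 2012, Theorem 2 on each Delaunay triangle + Lemma 5) — proved

Topic `Literature/Geometry/DiscreteGeometry`; provefact brick for `Hales2012_contactGraphTame`,
continuing `KissingFacets.lean` (the unit-sphere dictionary and Lemma 5 in facet form) and
`KissingMainEstimate.lean` (the per-triangle bounds of Theorem 2).  A facet of `conv X`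
(`X = V/2`, `V ∈ 𝒱`) with vertices `w 0, …, w (m−1)` in cyclic order is triangulated by the
diagonals from `w 0` into the fan triangles `(w 0, w (i+1), w (i+2))`, `i < m − 2` (Hales:
"`U_F`, up to a set of measure zero, is a disjoint union of cones over Delaunay triangles … We
may calculate the solid angle of `U_F` and also `τ(U_F)` by this triangulation").

* Part A: `trianglePenaltyLB x y z`, the constant of the main estimate for a triangle with side
  cosines `x, y, z` (a side is a contact iff its cosine is `1/2`; a long side has cosine
  `≤ κ₀`; a *very long* side has negative cosine): `0` (three contacts), `0.103`/`0` (two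
  contacts, third side not very long / very long), `0.27`/`0.36` (one contact, no / some very
  long side), `0.5`/`0.63` (no contact); and **`le_sphExcess_sub_sol0_of_sides`**: for a
  linearly independent unit triangle whose sides are contacts or long, pairwise `≥ −1/2`, with
  cosines summing to `> −3/4` and base cosine `≥ −1/3` in the isosceles contact case,
  `trianglePenaltyLB ≤ sphExcess − sol₀` (the eight side patterns reduced to
  `KissingMainEstimate.lean` by permuting the vertices).
* Part B: for twelve unit vectors with pairwise inner products `1/2` or `≤ κ₀`:
  `fanPenaltyLB X c i`, the constant of the `i`-th fan triangle of the facet of `c`;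
  `fanPenaltyLB_le` (it bounds that triangle's penalty, the hypotheses of Part A being supplied
  by `KissingFacets.lean`); **`sum_fanPenaltyLB_le_facet_weight`** (per facet:
  `Σ_{i<m−2} fanPenaltyLB ≤ 4π·frac(c) − (m − 2) sol₀`, by `SphericalPolygonFan`); and
  **`sum_sum_fanPenaltyLB_le`**: `Σ_c Σ_i fanPenaltyLB X c i ≤ 4π − 20 sol₀` — the budget
  inequality of Theorem 3 at facet level, and its `IsKissingConfig` form
  `IsKissingConfig.sum_fanPenaltyLB_le_budget` for `X = V/2`.

Everything is PROVED; no named facts.  Not here: the census drawn from the budget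
(`KissingContactCount.lean`).

## References
* T. C. Hales, arXiv:1209.6043 (2012): Theorem 2 and its proof (`d₃`, triangulation of
  `U_F`), Lemma 5. [`Hales2012`]
-/

noncomputable section

namespace Literature.Geometry.DiscreteGeometry

open Real RealInnerProductSpace InnerProductGeometry Finset

/-! ### Part A. The constant of the main estimate from the side cosines -/

/-- The number of contact sides (cosine `1/2`) among three side cosines. [folklore] -/
def contactCount (x y z : ℝ) : ℕ :=
  (if x = 1 / 2 then 1 else 0) + (if y = 1 / 2 then 1 else 0) + (if z = 1 / 2 then 1 else 0)

/-- **The constant of the main estimate for a Delaunay triangle from its three side cosines**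
(a side is a contact iff its cosine is `1/2`; "very long" means negative cosine, i.e. length
`> 2√2` on `S²(2)`): `0` for three contacts; `0.103` for two contacts unless the third side is
very long (then `0` — Hales's sharp case `(2,0,1)`); `0.27` for one contact, `0.36` if some side
is very long; `0.5` for no contact, `0.63` if some side is very long.
[cite: Hales2012, Theorem 2 (the function d₃)] -/
def trianglePenaltyLB (x y z : ℝ) : ℝ :=
  if contactCount x y z = 3 then 0
  else if contactCount x y z = 2 then (if x < 0 ∨ y < 0 ∨ z < 0 then 0 else 0.103)
  else if contactCount x y z = 1 then (if x < 0 ∨ y < 0 ∨ z < 0 then 0.36 else 0.27)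
  else (if x < 0 ∨ y < 0 ∨ z < 0 then 0.63 else 0.5)

/-- `trianglePenaltyLB` is nonnegative. [folklore] -/
theorem trianglePenaltyLB_nonneg (x y z : ℝ) : 0 ≤ trianglePenaltyLB x y z := by
  unfold trianglePenaltyLB
  split_ifs <;> norm_num

section Estimate

local notation "E3" => EuclideanSpace ℝ (Fin 3)

/-- **The main estimate for a triangle given by its side types** (assembling
`KissingMainEstimate.lean`): for linearly independent unit `a, b, c` whose side cosines
`x = ⟪b,c⟫, y = ⟪a,c⟫, z = ⟪a,b⟫` are each `1/2` or `≤ κ₀ = 1031/5000`, each `≥ −1/2`, sum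
to `> −3/4`, and are `≥ −1/3` for the base of an isosceles contact triangle,
`trianglePenaltyLB x y z ≤ sphExcess a b c − sol₀`.
[cite: Hales2012, Theorem 2 (A ≥ sol₀ + d₃(r,s,t))] -/
theorem le_sphExcess_sub_sol0_of_sides {a b c : E3} (ha : ‖a‖ = 1) (hb : ‖b‖ = 1)
    (hc : ‖c‖ = 1) (hli : LinearIndependent ℝ ![a, b, c])
    (hx : ⟪b, c⟫ = 1 / 2 ∨ (-1 / 2 ≤ ⟪b, c⟫ ∧ ⟪b, c⟫ ≤ 1031 / 5000))
    (hy : ⟪a, c⟫ = 1 / 2 ∨ (-1 / 2 ≤ ⟪a, c⟫ ∧ ⟪a, c⟫ ≤ 1031 / 5000))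
    (hz : ⟪a, b⟫ = 1 / 2 ∨ (-1 / 2 ≤ ⟪a, b⟫ ∧ ⟪a, b⟫ ≤ 1031 / 5000))
    (hsum : -3 / 4 < ⟪b, c⟫ + ⟪a, c⟫ + ⟪a, b⟫)
    (hix : ⟪a, c⟫ = 1 / 2 → ⟪a, b⟫ = 1 / 2 → -1 / 3 ≤ ⟪b, c⟫)
    (hiy : ⟪b, c⟫ = 1 / 2 → ⟪a, b⟫ = 1 / 2 → -1 / 3 ≤ ⟪a, c⟫)
    (hiz : ⟪b, c⟫ = 1 / 2 → ⟪a, c⟫ = 1 / 2 → -1 / 3 ≤ ⟪a, b⟫) :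
    trianglePenaltyLB ⟪b, c⟫ ⟪a, c⟫ ⟪a, b⟫ ≤ sphExcess a b c - hales_sol0 := by
  -- symmetric copies
  have hba : ⟪b, a⟫ = ⟪a, b⟫ := real_inner_comm a b
  have hca : ⟪c, a⟫ = ⟪a, c⟫ := real_inner_comm a c
  have hcb : ⟪c, b⟫ = ⟪b, c⟫ := real_inner_comm b c
  have hli_bac : LinearIndependent ℝ ![b, a, c] :=
    linearIndependent_triple_perm hli 1 0 2 (by decide) (by decide) (by decide)
  have hli_cab : LinearIndependent ℝ ![c, a, b] :=
    linearIndependent_triple_perm hli 2 0 1 (by decide) (by decide) (by decide)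
  have hli_acb : LinearIndependent ℝ ![a, c, b] :=
    linearIndependent_triple_perm hli 0 2 1 (by decide) (by decide) (by decide)
  have hli_bca : LinearIndependent ℝ ![b, c, a] :=
    linearIndependent_triple_perm hli 1 2 0 (by decide) (by decide) (by decide)
  have hli_cba : LinearIndependent ℝ ![c, b, a] :=
    linearIndependent_triple_perm hli 2 1 0 (by decide) (by decide) (by decide)
  have e_bac : sphExcess b a c = sphExcess a b c := sphExcess_swap₁₂ a b c
  have e_acb : sphExcess a c b = sphExcess a b c := sphExcess_swap₂₃ a b c
  have e_bca : sphExcess b c a = sphExcess a b c := sphExcess_rotate a b c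
  have e_cab : sphExcess c a b = sphExcess a b c := by rw [sphExcess_rotate b c a, e_bca]
  have e_cba : sphExcess c b a = sphExcess a b c := by rw [sphExcess_swap₂₃ c a b, e_cab]
  have hk : ¬((1031 : ℝ) / 5000 = 1 / 2) := by norm_num
  -- case distinction on the three contacts
  rcases hx with hx | hx <;> rcases hy with hy | hy <;> rcases hz with hz | hz
  · -- three contacts
    have hcc : contactCount ⟪b, c⟫ ⟪a, c⟫ ⟪a, b⟫ = 3 := by
      rw [contactCount, if_pos hx, if_pos hy, if_pos hz]
    rw [trianglePenaltyLB, if_pos hcc, sphExcess_eq_sol0_of_contact ha hb hc hz hy hx]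
    simp
  · -- contacts `bc`, `ac`; long `ab`: apex `c`, triangle `(c, a, b)`
    have hz' : ¬⟪a, b⟫ = 1 / 2 := fun h => hk (by linarith [hz.2])
    have hcc : contactCount ⟪b, c⟫ ⟪a, c⟫ ⟪a, b⟫ = 2 := by
      rw [contactCount, if_pos hx, if_pos hy, if_neg hz']
    rw [trianglePenaltyLB, if_neg (by rw [hcc]; norm_num), if_pos hcc, ← e_cab]
    split_ifs with hneg
    · have := sol0_le_sphExcess_of_isosceles hc ha hb hli_cab (by rw [hca, hy])
        (by rw [hcb, hx]) (hiz hx hy) (by linarith [hz.2])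
      linarith
    · push Not at hneg
      have := sol0_add_le_sphExcess_of_isosceles_short hc ha hb hli_cab (by rw [hca, hy])
        (by rw [hcb, hx]) (by linarith [hneg.2.2]) hz.2
      norm_num at this ⊢; linarith
  · -- contacts `bc`, `ab`; long `ac`: apex `b`, triangle `(b, a, c)`
    have hy' : ¬⟪a, c⟫ = 1 / 2 := fun h => hk (by linarith [hy.2])
    have hcc : contactCount ⟪b, c⟫ ⟪a, c⟫ ⟪a, b⟫ = 2 := by
      rw [contactCount, if_pos hx, if_neg hy', if_pos hz]
    rw [trianglePenaltyLB, if_neg (by rw [hcc]; norm_num), if_pos hcc, ← e_bac]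
    split_ifs with hneg
    · have := sol0_le_sphExcess_of_isosceles hb ha hc hli_bac (by rw [hba, hz]) hx
        (hiy hx hz) (by linarith [hy.2])
      linarith
    · push Not at hneg
      have := sol0_add_le_sphExcess_of_isosceles_short hb ha hc hli_bac (by rw [hba, hz]) hx
        (by linarith [hneg.2.1]) hy.2
      norm_num at this ⊢; linarith
  · -- contact `bc` only: triangle `(b, c, a)` (or `(c, b, a)` when `ab` is very long)
    have hy' : ¬⟪a, c⟫ = 1 / 2 := fun h => hk (by linarith [hy.2])
    have hz' : ¬⟪a, b⟫ = 1 / 2 := fun h => hk (by linarith [hz.2])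
    have hcc : contactCount ⟪b, c⟫ ⟪a, c⟫ ⟪a, b⟫ = 1 := by
      rw [contactCount, if_pos hx, if_neg hy', if_neg hz']
    rw [trianglePenaltyLB, if_neg (by rw [hcc]; norm_num), if_neg (by rw [hcc]; norm_num),
      if_pos hcc]
    split_ifs with hneg
    · rcases hneg with h | h | h
      · linarith
      · rw [← e_bca]
        have := sol0_add_le_sphExcess_of_one_contact_of_nonpos hb hc ha hli_bca hx
          (by rw [hba]; exact hz) (by rw [hca]; exact ⟨hy.1, h.le⟩)
        norm_num at this ⊢; linarith
      · rw [← e_cba]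
        have := sol0_add_le_sphExcess_of_one_contact_of_nonpos hc hb ha hli_cba
          (by rw [hcb, hx]) (by rw [hca]; exact hy) (by rw [hba]; exact ⟨hz.1, h.le⟩)
        norm_num at this ⊢; linarith
    · rw [← e_bca]
      have := sol0_add_le_sphExcess_of_one_contact hb hc ha hli_bca hx (by rw [hba]; exact hz)
        (by rw [hca]; exact hy)
      norm_num at this ⊢; linarith
  · -- contacts `ac`, `ab`; long `bc`: apex `a`, triangle `(a, b, c)`
    have hx' : ¬⟪b, c⟫ = 1 / 2 := fun h => hk (by linarith [hx.2])
    have hcc : contactCount ⟪b, c⟫ ⟪a, c⟫ ⟪a, b⟫ = 2 := by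
      rw [contactCount, if_neg hx', if_pos hy, if_pos hz]
    rw [trianglePenaltyLB, if_neg (by rw [hcc]; norm_num), if_pos hcc]
    split_ifs with hneg
    · have := sol0_le_sphExcess_of_isosceles ha hb hc hli hz hy (hix hy hz) (by linarith [hx.2])
      linarith
    · push Not at hneg
      have := sol0_add_le_sphExcess_of_isosceles_short ha hb hc hli hz hy
        (by linarith [hneg.1]) hx.2
      norm_num at this ⊢; linarith
  · -- contact `ac` only: triangle `(a, c, b)` (or `(c, a, b)` when `ab` is very long)
    have hx' : ¬⟪b, c⟫ = 1 / 2 := fun h => hk (by linarith [hx.2])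
    have hz' : ¬⟪a, b⟫ = 1 / 2 := fun h => hk (by linarith [hz.2])
    have hcc : contactCount ⟪b, c⟫ ⟪a, c⟫ ⟪a, b⟫ = 1 := by
      rw [contactCount, if_neg hx', if_pos hy, if_neg hz']
    rw [trianglePenaltyLB, if_neg (by rw [hcc]; norm_num), if_neg (by rw [hcc]; norm_num),
      if_pos hcc]
    split_ifs with hneg
    · rcases hneg with h | h | h
      · rw [← e_acb]
        have := sol0_add_le_sphExcess_of_one_contact_of_nonpos ha hc hb hli_acb hy hz
          (by rw [hcb]; exact ⟨hx.1, h.le⟩)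
        norm_num at this ⊢; linarith
      · linarith
      · rw [← e_cab]
        have := sol0_add_le_sphExcess_of_one_contact_of_nonpos hc ha hb hli_cab
          (by rw [hca, hy]) (by rw [hcb]; exact hx) ⟨hz.1, h.le⟩
        norm_num at this ⊢; linarith
    · rw [← e_acb]
      have := sol0_add_le_sphExcess_of_one_contact ha hc hb hli_acb hy hz
        (by rw [hcb]; exact hx)
      norm_num at this ⊢; linarith
  · -- contact `ab` only: triangle `(a, b, c)` (or `(b, a, c)` when `ac` is very long)
    have hx' : ¬⟪b, c⟫ = 1 / 2 := fun h => hk (by linarith [hx.2])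
    have hy' : ¬⟪a, c⟫ = 1 / 2 := fun h => hk (by linarith [hy.2])
    have hcc : contactCount ⟪b, c⟫ ⟪a, c⟫ ⟪a, b⟫ = 1 := by
      rw [contactCount, if_neg hx', if_neg hy', if_pos hz]
    rw [trianglePenaltyLB, if_neg (by rw [hcc]; norm_num), if_neg (by rw [hcc]; norm_num),
      if_pos hcc]
    split_ifs with hneg
    · rcases hneg with h | h | h
      · have := sol0_add_le_sphExcess_of_one_contact_of_nonpos ha hb hc hli hz hy
          ⟨hx.1, h.le⟩
        norm_num at this ⊢; linarith
      · rw [← e_bac]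
        have := sol0_add_le_sphExcess_of_one_contact_of_nonpos hb ha hc hli_bac
          (by rw [hba, hz]) hx ⟨hy.1, h.le⟩
        norm_num at this ⊢; linarith
      · linarith
    · have := sol0_add_le_sphExcess_of_one_contact ha hb hc hli hz hy hx
      norm_num at this ⊢; linarith
  · -- no contact
    have hx' : ¬⟪b, c⟫ = 1 / 2 := fun h => hk (by linarith [hx.2])
    have hy' : ¬⟪a, c⟫ = 1 / 2 := fun h => hk (by linarith [hy.2])
    have hz' : ¬⟪a, b⟫ = 1 / 2 := fun h => hk (by linarith [hz.2])
    have hcc : contactCount ⟪b, c⟫ ⟪a, c⟫ ⟪a, b⟫ = 0 := by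
      rw [contactCount, if_neg hx', if_neg hy', if_neg hz']
    rw [trianglePenaltyLB, if_neg (by rw [hcc]; norm_num), if_neg (by rw [hcc]; norm_num),
      if_neg (by rw [hcc]; norm_num)]
    split_ifs with hneg
    · rcases hneg with h | h | h
      · have := sol0_add_le_sphExcess_of_no_contact_of_nonpos ha hb hc hli ⟨hx.1, h.le⟩ hy hz
          hsum
        norm_num at this ⊢; linarith
      · rw [← e_bac]
        have := sol0_add_le_sphExcess_of_no_contact_of_nonpos hb ha hc hli_bac ⟨hy.1, h.le⟩ hx
          (by rw [hba]; exact hz) (by rw [hba]; linarith)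
        norm_num at this ⊢; linarith
      · rw [← e_cab]
        have := sol0_add_le_sphExcess_of_no_contact_of_nonpos hc ha hb hli_cab ⟨hz.1, h.le⟩
          (by rw [hcb]; exact hx) (by rw [hca]; exact hy) (by rw [hcb, hca]; linarith)
        norm_num at this ⊢; linarith
    · have := sol0_add_le_sphExcess_of_no_contact ha hb hc hli hx hy hz hsum
      norm_num at this ⊢; linarith

end Estimate

/-! ### Part B. The fan triangles of the facets and the budget inequality -/

section Facets

local notation "E3" => EuclideanSpace ℝ (Fin 3)

variable {X : Finset E3}

/-- **The constant of the main estimate for the `i`-th fan triangle `(w 0, w (i+1), w (i+2))`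
of the facet of `c`** (vertices `w = facetVertex X c`; `0` if `c` is not a facet normal — a
junk value). [cite: Hales2012, Theorem 2] -/
def fanPenaltyLB (X : Finset E3) (c : E3) (i : ℕ) : ℝ :=
  if hc : c ≠ 0 then
    trianglePenaltyLB ⟪facetVertex X c hc (i + 1), facetVertex X c hc (i + 2)⟫
      ⟪facetVertex X c hc 0, facetVertex X c hc (i + 2)⟫
      ⟪facetVertex X c hc 0, facetVertex X c hc (i + 1)⟫
  else 0

/-- `fanPenaltyLB` is nonnegative. [folklore] -/
theorem fanPenaltyLB_nonneg (X : Finset E3) (c : E3) (i : ℕ) : 0 ≤ fanPenaltyLB X c i := by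
  unfold fanPenaltyLB
  split_ifs
  · exact trianglePenaltyLB_nonneg _ _ _
  · exact le_rfl

/-- Two distinct vertices of a facet, in a configuration whose distinct pairs have inner product
`1/2` or `≤ κ₀`, have inner product `1/2` or in `[−1/2, κ₀]`. [folklore] -/
theorem inner_cases_of_tight (h12 : X.card = 12) (hX1 : ∀ y ∈ X, ‖y‖ = 1)
    (hV : ∀ y ∈ X, ∀ y' ∈ X, y ≠ y' → ⟪y, y'⟫ = 1 / 2 ∨ ⟪y, y'⟫ ≤ 1031 / 5000)
    {c : E3} (hc : c ∈ facetNormals X) {y y' : E3} (hy : y ∈ tightSet X c)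
    (hy' : y' ∈ tightSet X c) (hne : y ≠ y') :
    ⟪y, y'⟫ = 1 / 2 ∨ (-1 / 2 ≤ ⟪y, y'⟫ ∧ ⟪y, y'⟫ ≤ 1031 / 5000) := by
  have hp : ∀ y ∈ X, ∀ y' ∈ X, y ≠ y' → ⟪y, y'⟫ ≤ 1 / 2 := fun y hy y' hy' h =>
    (hV y hy y' hy' h).elim le_of_eq fun h' => by linarith
  rcases hV y (mem_tightSet.1 hy).1 y' (mem_tightSet.1 hy').1 hne with h | h
  · exact Or.inl h
  · exact Or.inr ⟨(neg_half_lt_inner_of_tight h12 hX1 hp hc hy hy').le, h⟩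

/-- **The main estimate on a fan triangle of a facet.**  For twelve unit vectors whose distinct
pairs have inner product `1/2` or `≤ κ₀`, a facet normal `c` and `i + 2 < m_c`: the penalty
`sphExcess − sol₀` of the fan triangle `(w 0, w (i+1), w (i+2))` is at least
`fanPenaltyLB X c i`. [cite: Hales2012, Theorem 2] -/
theorem fanPenaltyLB_le (h12 : X.card = 12) (hX1 : ∀ y ∈ X, ‖y‖ = 1)
    (hV : ∀ y ∈ X, ∀ y' ∈ X, y ≠ y' → ⟪y, y'⟫ = 1 / 2 ∨ ⟪y, y'⟫ ≤ 1031 / 5000)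
    {c : E3} (hc : c ∈ facetNormals X) {i : ℕ}
    (hi : i + 2 < (facetAngles X c (ne_zero_of_mem_facetNormals hX1 hc)).card) :
    fanPenaltyLB X c i ≤
      sphExcess (facetVertex X c (ne_zero_of_mem_facetNormals hX1 hc) 0)
        (facetVertex X c (ne_zero_of_mem_facetNormals hX1 hc) (i + 1))
        (facetVertex X c (ne_zero_of_mem_facetNormals hX1 hc) (i + 2)) - hales_sol0 := by
  have hp : ∀ y ∈ X, ∀ y' ∈ X, y ≠ y' → ⟪y, y'⟫ ≤ 1 / 2 := fun y hy y' hy' h =>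
    (hV y hy y' hy' h).elim le_of_eq fun h' => by linarith
  set hc0 := ne_zero_of_mem_facetNormals hX1 hc
  set w := facetVertex X c hc0 with hw
  rw [fanPenaltyLB, dif_pos hc0]
  -- the three vertices: tight, unit, distinct, positively oriented
  have h0 : w 0 ∈ tightSet X c := facetVertex_mem hc0 (by omega)
  have h1 : w (i + 1) ∈ tightSet X c := facetVertex_mem hc0 (by omega)
  have h2 : w (i + 2) ∈ tightSet X c := facetVertex_mem hc0 hi
  have hu0 := hX1 _ (mem_tightSet.1 h0).1
  have hu1 := hX1 _ (mem_tightSet.1 h1).1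
  have hu2 := hX1 _ (mem_tightSet.1 h2).1
  have hinj := facetVertex_injOn (X := X) hc0
  have hne01 : w 0 ≠ w (i + 1) := fun h => by
    have := hinj (Finset.mem_coe.2 (Finset.mem_range.2 (by omega)))
      (Finset.mem_coe.2 (Finset.mem_range.2 (by omega))) h
    omega
  have hne02 : w 0 ≠ w (i + 2) := fun h => by
    have := hinj (Finset.mem_coe.2 (Finset.mem_range.2 (by omega)))
      (Finset.mem_coe.2 (Finset.mem_range.2 hi)) h
    omega
  have hne12 : w (i + 1) ≠ w (i + 2) := fun h => by
    have := hinj (Finset.mem_coe.2 (Finset.mem_range.2 (by omega)))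
      (Finset.mem_coe.2 (Finset.mem_range.2 hi)) h
    omega
  have hor := orient3_facetVertex_pos hX1 hc (i := 0) (j := i + 1) (k := i + 2) (by omega)
    (by omega) hi
  have hli : LinearIndependent ℝ ![w 0, w (i + 1), w (i + 2)] :=
    linearIndependent_of_orient3_ne_zero hor.ne'
  refine le_sphExcess_sub_sol0_of_sides hu0 hu1 hu2 hli
    (inner_cases_of_tight h12 hX1 hV hc h1 h2 hne12)
    (inner_cases_of_tight h12 hX1 hV hc h0 h2 hne02)
    (inner_cases_of_tight h12 hX1 hV hc h0 h1 hne01)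
    (by linarith [sum_inner_gt_of_tight h12 hX1 hp hc h0 h1 h2])
    (fun ha hb => (neg_third_lt_inner_of_isosceles_tight h12 hX1 hp hc h0 h1 h2 hb ha hne12).le)
    (fun ha hb => ?_) (fun ha hb => ?_)
  · -- isosceles at `w (i+1)`: `⟪w(i+1), w(i+2)⟫ = ⟪w(i+1), w 0⟫ = 1/2`
    have hb' : ⟪w (i + 1), w 0⟫ = 1 / 2 := by rw [real_inner_comm]; exact hb
    have := neg_third_lt_inner_of_isosceles_tight h12 hX1 hp hc h1 h0 h2 hb' ha hne02
    exact this.le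
  · -- isosceles at `w (i+2)`: `⟪w(i+2), w 0⟫ = ⟪w(i+2), w(i+1)⟫ = 1/2`
    have ha' : ⟪w (i + 2), w (i + 1)⟫ = 1 / 2 := by rw [real_inner_comm]; exact ha
    have hb' : ⟪w (i + 2), w 0⟫ = 1 / 2 := by rw [real_inner_comm]; exact hb
    have := neg_third_lt_inner_of_isosceles_tight h12 hX1 hp hc h2 h0 h1 hb' ha' hne01
    exact this.le

/-- **The main estimate on a facet**: the constants of the fan triangles of the facet of `c`
add up to at most its weight `4π · frac(c) − (m_c − 2) sol₀`.
[cite: Hales2012, Theorem 2 and Lemma 4 (τ(U) ≥ Σ over the Delaunay triangles)] -/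
theorem sum_fanPenaltyLB_le_facet_weight (h12 : X.card = 12) (hX1 : ∀ y ∈ X, ‖y‖ = 1)
    (hV : ∀ y ∈ X, ∀ y' ∈ X, y ≠ y' → ⟪y, y'⟫ = 1 / 2 ∨ ⟪y, y'⟫ ≤ 1031 / 5000)
    (h0 : (0 : E3) ∈ interior (convexHull ℝ (X : Set E3))) {c : E3} (hc : c ∈ facetNormals X) :
    ∑ i ∈ range ((tightSet X c).card - 2), fanPenaltyLB X c i ≤
      4 * π * ballFraction (0 : E3) (argmaxCone (facetNormals X) c) -
        ((tightSet X c).card - 2) * hales_sol0 := by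
  set hc0 := ne_zero_of_mem_facetNormals hX1 hc
  set m := (facetAngles X c hc0).card with hm
  have hmt : (tightSet X c).card = m := (card_facetAngles hX1 hc0).symm
  have hm3 : 3 ≤ m := by rw [← hmt]; exact three_le_card_tightSet hc
  have hw : ∀ i j k, i < j → j < k → k < m →
      0 < orient3 (facetVertex X c hc0 i) (facetVertex X c hc0 j) (facetVertex X c hc0 k) :=
    fun i j k hij hjk hk => orient3_facetVertex_pos hX1 hc hij hjk hk
  have hfan := sum_fan_angles_sub_pi_le hm3 hw
  rw [← argmaxCone_eq_polyCone hX1 h0 hc] at hfan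
  rw [hmt]
  -- each fan constant is at most the excess minus `sol₀`
  have hle : ∀ i ∈ range (m - 2), fanPenaltyLB X c i ≤
      sphExcess (facetVertex X c hc0 0) (facetVertex X c hc0 (i + 1))
        (facetVertex X c hc0 (i + 2)) - hales_sol0 := fun i hi =>
    fanPenaltyLB_le h12 hX1 hV hc (by have := mem_range.1 hi; omega)
  have hsum := Finset.sum_le_sum hle
  rw [Finset.sum_sub_distrib, Finset.sum_const, Finset.card_range, nsmul_eq_mul] at hsum
  have hex : ∑ i ∈ range (m - 2), sphExcess (facetVertex X c hc0 0)
      (facetVertex X c hc0 (i + 1)) (facetVertex X c hc0 (i + 2)) ≤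
      4 * π * ballFraction (0 : E3) (argmaxCone (facetNormals X) c) := by
    simpa only [sphExcess] using hfan
  have hcast : ((m - 2 : ℕ) : ℝ) = (m : ℝ) - 2 := by
    rw [Nat.cast_sub (by omega)]; norm_num
  rw [hcast] at hsum
  linarith

/-- **The budget inequality (Theorem 2 + Lemma 5 at facet level)**: for twelve unit vectors
whose distinct pairs have inner product `1/2` or `≤ κ₀`, the constants of the main estimate
over all fan triangles of all facets add up to at most `4π − 20 sol₀ (≈ 1.5407 < tgt)`.
[cite: Hales2012, Lemma 5 and Theorem 3 (proof, weights: "Σ_F τ = 4π − 20 sol₀ < tgt")] -/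
theorem sum_sum_fanPenaltyLB_le (h12 : X.card = 12) (hX1 : ∀ y ∈ X, ‖y‖ = 1)
    (hV : ∀ y ∈ X, ∀ y' ∈ X, y ≠ y' → ⟪y, y'⟫ = 1 / 2 ∨ ⟪y, y'⟫ ≤ 1031 / 5000) :
    ∑ c ∈ facetNormals X, ∑ i ∈ range ((tightSet X c).card - 2), fanPenaltyLB X c i ≤
      4 * π - 20 * hales_sol0 := by
  have hp : ∀ y ∈ X, ∀ y' ∈ X, y ≠ y' → ⟪y, y'⟫ ≤ 1 / 2 := fun y hy y' hy' h =>
    (hV y hy y' hy' h).elim le_of_eq fun h' => by linarith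
  have h0 := zero_mem_interior_convexHull_of_twelve_unit h12 hX1 hp
  rw [← sum_facet_weight_eq h12 hX1 h0]
  exact Finset.sum_le_sum fun c hc => sum_fanPenaltyLB_le_facet_weight h12 hX1 hV h0 hc

end Facets

/-! ### Part C. The kissing configuration `V ∈ 𝒱` and its unit configuration `V/2` -/

section Kissing

local notation "E3" => EuclideanSpace ℝ (Fin 3)

variable {S : Set E3}

/-- **The unit configuration `V/2`** of a kissing configuration `V ∈ 𝒱` (a `Finset` of twelve
unit vectors). [cite: Hales2012, Definition 1] -/
def IsKissingConfig.unitConfig (hS : IsKissingConfig S) : Finset E3 :=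
  hS.finite.toFinset.image fun s => (1 / 2 : ℝ) • s

/-- Membership in the unit configuration. [folklore] -/
theorem IsKissingConfig.mem_unitConfig (hS : IsKissingConfig S) {y : E3} :
    y ∈ hS.unitConfig ↔ ∃ s ∈ S, (1 / 2 : ℝ) • s = y := by
  unfold IsKissingConfig.unitConfig
  simp only [Finset.mem_image, Set.Finite.mem_toFinset]

/-- The unit configuration has twelve points. [cite: Hales2012, Definition 1] -/
theorem IsKissingConfig.card_unitConfig (hS : IsKissingConfig S) : hS.unitConfig.card = 12 := by
  unfold IsKissingConfig.unitConfig
  rw [Finset.card_image_of_injective _ (smul_right_injective E3 (by norm_num : (1 / 2 : ℝ) ≠ 0)),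
    ← Set.ncard_coe_finset, Set.Finite.coe_toFinset, hS.ncard_eq]

/-- The unit configuration consists of unit vectors. [cite: Hales2012, Definition 1] -/
theorem IsKissingConfig.norm_of_mem_unitConfig (hS : IsKissingConfig S) {y : E3}
    (hy : y ∈ hS.unitConfig) : ‖y‖ = 1 := by
  obtain ⟨s, hs, rfl⟩ := hS.mem_unitConfig.1 hy
  rw [norm_smul, hS.norm_eq hs]; norm_num

/-- **The separation property on the unit sphere**: distinct points of `V/2` have inner product
`1/2` (contact, distance `2` in `V`) or `≤ κ₀ = 1031/5000` (distance `≥ 2h₀ = 2.52` in `V`).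
[cite: Hales2012, Definition 1] -/
theorem IsKissingConfig.inner_of_mem_unitConfig (hS : IsKissingConfig S) {y y' : E3}
    (hy : y ∈ hS.unitConfig) (hy' : y' ∈ hS.unitConfig) (hne : y ≠ y') :
    ⟪y, y'⟫ = 1 / 2 ∨ ⟪y, y'⟫ ≤ 1031 / 5000 := by
  obtain ⟨s, hs, rfl⟩ := hS.mem_unitConfig.1 hy
  obtain ⟨t, ht, rfl⟩ := hS.mem_unitConfig.1 hy'
  have hst : s ≠ t := fun h => hne (by rw [h])
  have hd : dist s t ^ 2 = 8 - 2 * ⟪s, t⟫ := dist_sq_eq_of_norm_eq_two (hS.norm_eq hs) (hS.norm_eq ht)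
  have hinner : ⟪(1 / 2 : ℝ) • s, (1 / 2 : ℝ) • t⟫ = ⟪s, t⟫ / 4 := by
    rw [real_inner_smul_left, real_inner_smul_right]; ring
  rw [hinner]
  rcases hS.2.2 s hs t ht with h | h | h
  · exact absurd h hst
  · left
    rw [h] at hd
    linarith
  · right
    rw [hales_h0_eq] at h
    have h0 : (0 : ℝ) ≤ 2 * 1.26 := by norm_num
    have h2 : (2 * 1.26) ^ 2 ≤ dist s t ^ 2 := pow_le_pow_left₀ h0 h 2
    rw [hd] at h2
    norm_num at h2 ⊢
    linarith

/-- **The budget inequality for `V ∈ 𝒱`**: over the facets of the Delaunay polyhedron of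
`V/2` and their fan triangles, `Σ fanPenaltyLB ≤ 4π − 20 sol₀`.
[cite: Hales2012, Lemma 5 and Theorem 2] -/
theorem IsKissingConfig.sum_fanPenaltyLB_le_budget (hS : IsKissingConfig S) :
    ∑ c ∈ facetNormals hS.unitConfig,
        ∑ i ∈ range ((tightSet hS.unitConfig c).card - 2), fanPenaltyLB hS.unitConfig c i ≤
      4 * π - 20 * hales_sol0 :=
  sum_sum_fanPenaltyLB_le hS.card_unitConfig (fun _ hy => hS.norm_of_mem_unitConfig hy)
    fun _ hy _ hy' hne => hS.inner_of_mem_unitConfig hy hy' hne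

end Kissing

end Literature.Geometry.DiscreteGeometry

end
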